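import Summits.ABC.IUTFork.ForkPacketPreHull
import HarnessLib

/-!
# The fork at [IUTchIII] Corollary 3.12 — MIXED summands: where (Ind1) brings a UNIT theta slot, every summand
# reading HOLDS (skeleton XXVIc; the real-packet form of RISK 7 / the (Ind1) reading fork of skeleton XXII)

Record-only file (D-0012) of the abc-iut cell (deliverable (a), skeleton seat abc-iut-skel, gen 6); TAKES NO SIDE.
The COMPLEMENT of XXVI (`ForkPacketReal`, p417081) / XXVIb (`ForkPacketPreHull`, p417570). There: at a summand
`v⃗` all of whose theta slots are deep (the diagonal summand `(v,…,v)` of a bad place), every summand-level reading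
of Step (xi) — hull-level R0/R2/R3/R4/R4′ beyond the [IUTchIV] Prop. 1.4 discrepancy, pre-hull at once — is FALSE.
Here: at a summand `v⃗ ∈ 𝕍_p^{j+1}` with ONE slot `i` whose place `w = v⃗(i)` carries a UNIT theta value (a good
place, or any place where the Θ-pilot's local value is a unit), and (Ind3)-data containing the bare region on the
permuted summand that (Ind1) uses to move that slot to the distinguished position, the (Ind1)·(Ind2)-orbit contains
the WHOLE unit ball `O_{v⃗}` (`orbit_contains_O`: (Ind1) transports the bare region `ι_j(t_w)·O_{v⃗∘σ}` to
`ι_{σ(j)}(t_w)·O_{v⃗} = O_{v⃗}` for a unit `t_w` — c312-d1 `realPrimePacket_perm_image_bare` +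
`iota_unit_smul_normalizedPacket`),
hence (`readings_hold_of_unit_slot`) R2, R3, R4, the pre-hull `SingleImageReading`, and — granted admissibility of
the hull — R0 and R4′ all HOLD at `v⃗`, however deep the q-value `q̲` at `v⃗`'s last place is (`‖q̲‖ ≤ 1`).

So in the sharp real model with (Ind1) = all slot permutations (c312-d1/c312-3; Dupuy–Hilado §4.7), the PER-PACKET
reading at `(j, p)` — the [IUTchIII] Rmk. 3.1.1 (ii)-weighted sum over the summands `v⃗ ∈ 𝕍_p^{j+1}` — is a
COMPETITION: deficits at the all-bad tuples (XXVI/XXVIb; weight fraction `β_p^{j+1}` if `β_p` is the weight of the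
bad places over `p`), surpluses at every tuple with a good slot (this file). This is the real-packet form of the
(Ind1) reading fork of skeleton XXII (`ForkInd1`: (U) union reading `gainMin` = least slot gain, STRICTLY below the
(S) symmetrised average when two places differ — [IUTchIV] Step (v) p. 27 l. 62–65 «taken into account by the
arbitrary nature of the automorphism φ» vs p. 28 l. 66–70 «symmetrizing … does not affect»; VERDICT RISK 7; c312-d1
STEPV-IND1-NOTE): under the orbit-over-all-`σ` model the Θ-gain of a packet survives only on the all-bad tuples.
CONSEQUENCE for the (G1′) tag (plan/ADJUDICATION-SPEC §2): the per-packet readings are not «false in the intended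
model» simpliciter — they are FALSE at the summands that carry the Θ-gain (all-bad, deep or large `j`; all packets
when `𝕍` has one place over `p`, e.g. `F_mod = ℚ`) and TRUE at mixed summands; STRONGER-THAN-PRINT stands.
CONCORDANCE (same night, three levels, complementary): abc-iut-w5-d157's `DHData.not_perPrimeReading_of_deep` /
`not_perPacketReading_of_deep` (`LDHPerPrimeReading` p417488, `LDHPerPacketReading` p417638; witness p417819) prove the
R0 failure at the Dupuy–Hilado level for GENUINE-type inputs with ONE place over `p` (their §4 remarks, as here, that with
a good place over the same `p` the Step (v) slot-minimum loses the Θ-gain); abc-iut-c312-10's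
`Cor312Vol.not_pointwise_of_deep_packet` (`Cor312ThetaLocalBound` p417644) is the frozen-`Setting` form modulo named
container numerics. The present files XXVI/XXVIb/XXVIc sit one level below both (raw summand of c312-3's real packet,
arbitrary sharp (Ind3)-data, the set-level / iso / pre-hull readings, and the mixed-summand converse).
Sources: [IUTchIV] kurims `paper:url-56bcb0f95768` pp. 27–29; Dupuy–Hilado arXiv:2004.13228 §3.9, §4.7, §4.9,
§4.11. [claim: Mochizuki2012, status: disputed]; [cite: DupuyHilado2025, §3.9, §4.7, §4.11]. typed ≠ proved.
-/

noncomputable section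

open Set MeasureTheory NumberField IsDedekindDomain
open scoped Pointwise

namespace Summit.ABC.IUTFork.PacketReal

open Literature.IUT.LogVolume

variable {F : Type} [Field F] [NumberField F]
variable (p : ℕ) [Fact p.Prime] (𝔽 : LocalFields F p)

/-! ## 1. Integral slot scalars keep the unit ball, unit slot scalars fix it (any packet) -/

section Packet

variable {I : Type} [DecidableEq I]
variable (k : I → Type) [∀ i, NontriviallyNormedField (k i)] [∀ i, NormedAlgebra ℚ_[p] (k i)]

/-- `ι_i(a)·(R_I)^∼ ⊆ (R_I)^∼` for `‖a‖ ≤ 1`: `ι_i(a) = 1 ⊗ ⋯ ⊗ a ⊗ ⋯ ⊗ 1` is a pure tensor of integers, hence in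
`R_I ⊆ (R_I)^∼` ([IUTchIV] Prop. 1.1; abc-iut-S1 `purePacket_mem_integerPacket`).
[cite: Mochizuki2012, IUTchIV Prop. 1.1 p. 9] -/
theorem iota_smul_normalizedPacket_subset (i : I) {a : k i} (ha : ‖a‖ ≤ 1) :
    iota p k i a • (normalizedPacket p k : Set (PacketAlgebra p k)) ⊆ normalizedPacket p k := by
  have hmem : iota p k i a ∈ normalizedPacket p k := by
    rw [iota_eq_purePacket]
    refine integerPacket_le_normalizedPacket p k (purePacket_mem_integerPacket p k ?_)
    intro i'
    by_cases h : i' = i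
    · subst h
      rw [Pi.mulSingle_eq_same]
      exact ha
    · rw [Pi.mulSingle_eq_of_ne h, norm_one]
  rintro _ ⟨y, hy, rfl⟩
  exact (normalizedPacket p k).mul_mem hmem hy

/-- `ι_i(u)·(R_I)^∼ = (R_I)^∼` for a UNIT `u` (`‖u‖ = 1`): `ι_i` is an algebra map, so `ι_i(u)·ι_i(u⁻¹) = 1` and
both are integral. [cite: Mochizuki2012, IUTchIV Prop. 1.1 p. 9] -/
theorem iota_unit_smul_normalizedPacket (i : I) (u : (k i)ˣ) (hu : ‖(u : k i)‖ = 1) :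
    iota p k i (u : k i) • (normalizedPacket p k : Set (PacketAlgebra p k)) = normalizedPacket p k := by
  refine (iota_smul_normalizedPacket_subset p k i hu.le).antisymm ?_
  intro y hy
  have hu' : ‖((u⁻¹ : (k i)ˣ) : k i)‖ ≤ 1 := by
    rw [Units.val_inv_eq_inv_val, norm_inv, hu, inv_one]
  refine ⟨iota p k i ((u⁻¹ : (k i)ˣ) : k i) * y,
    iota_smul_normalizedPacket_subset p k i hu' ⟨y, hy, rfl⟩, ?_⟩
  show iota p k i (u : k i) * (iota p k i ((u⁻¹ : (k i)ˣ) : k i) * y) = y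
  rw [← mul_assoc, ← map_mul, Units.mul_inv, map_one, one_mul]

end Packet

/-- The q-pilot region `ι_j(q̲)·O_{v⃗}` lies in `O_{v⃗}` for an integral q-value (`‖q̲‖ ≤ 1`).
[cite: DupuyHilado2025, §3.9] -/
theorem pilotRegion_subset_O {j : ℕ} (e : Fin (j + 1) → placesOver F p) (q : (𝔽.k (e (Fin.last j)))ˣ)
    (hq : ‖(q : 𝔽.k (e (Fin.last j)))‖ ≤ 1) : pilotRegion p 𝔽 e q ⊆ (realPrimePacket p 𝔽).O j e := by
  have h' : pilotRegion p 𝔽 e q = iota p (fun i => 𝔽.k (e i)) (Fin.last j) (q : 𝔽.k (e (Fin.last j))) •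
      (normalizedPacket p (fun i => 𝔽.k (e i)) : Set (PacketAlgebra p (fun i => 𝔽.k (e i)))) :=
    realPrimePacket_peel_image p 𝔽 q _
  rw [h']
  exact iota_smul_normalizedPacket_subset p (fun i => 𝔽.k (e i)) (Fin.last j) hq

/-! ## 2. A unit theta slot puts the whole unit ball into the orbit -/

section UnitSlot

variable {p 𝔽}
variable {j : ℕ} (e : Fin (j + 1) → placesOver F p) (t : ∀ v : placesOver F p, (𝔽.k v)ˣ)
  (B : (realPrimePacket p 𝔽).Region) (σ : Equiv.Perm (Fin (j + 1)))
  (hBσ : pilotRegion p 𝔽 (e ∘ σ) (t (e (σ (Fin.last j)))) ⊆ B j (e ∘ σ))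
  (hunit : ‖(t (e (σ (Fin.last j))) : 𝔽.k (e (σ (Fin.last j))))‖ = 1)
include hBσ hunit

/-- **A unit theta slot puts `O_{v⃗}` into the orbit.** If the (Ind3)-datum on the permuted summand `v⃗ ∘ σ` contains
its bare region and the theta value at the place `v⃗(σ(j))` is a unit, then `O_{v⃗} = ι_{σ(j)}(t)·O_{v⃗} =
perm_σ(bare region) ⊆ perm_σ(B_{v⃗∘σ})` lies in the orbit (with `g = 1`). [cite: DupuyHilado2025, §3.9, §4.7, §4.11] -/
theorem O_subset_orbitMember :
    (realPrimePacket p 𝔽).O j e ⊆ (1 : (realPrimePacket p 𝔽).G₂ j e) • ((realPrimePacket p 𝔽).perm σ e '' B j (e ∘ σ)) := by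
  rw [one_smul]
  have hbare : (realPrimePacket p 𝔽).perm σ e '' pilotRegion p 𝔽 (e ∘ σ) (t (e (σ (Fin.last j)))) =
      (realPrimePacket p 𝔽).O j e :=
    (realPrimePacket_perm_image_bare p 𝔽 σ e (t (e (σ (Fin.last j))))).trans
      (iota_unit_smul_normalizedPacket p (fun i => 𝔽.k (e i)) (σ (Fin.last j)) _ hunit)
  rw [← hbare]
  exact Set.image_mono hBσ

/-- … hence `O_{v⃗}` lies in the orbit … [cite: DupuyHilado2025, §4.11] -/
theorem orbit_contains_O : (realPrimePacket p 𝔽).O j e ⊆ orbit p 𝔽 e B :=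
  (O_subset_orbitMember e t B σ hBσ hunit).trans
    (Set.subset_iUnion₂ (s := fun (g : (realPrimePacket p 𝔽).G₂ j e) (σ' : Equiv.Perm (Fin (j + 1))) =>
      g • ((realPrimePacket p 𝔽).perm σ' e '' B j (e ∘ σ'))) 1 σ)

/-- … and in the Θ-hull. [cite: DupuyHilado2025, §4.12] -/
theorem thetaHull_contains_O : (realPrimePacket p 𝔽).O j e ⊆ thetaHull p 𝔽 e B :=
  (orbit_contains_O e t B σ hBσ hunit).trans (orbit_subset_thetaHull p 𝔽 e B)

/-! ## 3. Every summand reading HOLDS at such a summand -/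

variable (q : (𝔽.k (e (Fin.last j)))ˣ) (hq : ‖(q : 𝔽.k (e (Fin.last j)))‖ ≤ 1)
include hq

/-- **R3 HOLDS at `v⃗`**: the q-pilot region lies in the orbit itself. [claim: Mochizuki2012, status: disputed] -/
theorem memReading_of_unit_slot : MemReading p 𝔽 e q B :=
  (pilotRegion_subset_O p 𝔽 e q hq).trans (orbit_contains_O e t B σ hBσ hunit)

/-- **R2 HOLDS at `v⃗`**: the q-pilot region lies in the Θ-hull. [claim: Mochizuki2012, status: disputed] -/
theorem subsetReading_of_unit_slot : SubsetReading p 𝔽 e q B :=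
  (pilotRegion_subset_O p 𝔽 e q hq).trans (thetaHull_contains_O e t B σ hBσ hunit)

/-- **R4 HOLDS at `v⃗`** (with the identity as the isomorphism). [claim: Mochizuki2012, status: disputed] -/
theorem isoReading_of_unit_slot : IsoReading p 𝔽 e q B :=
  ⟨1, by rw [one_smul]; exact subsetReading_of_unit_slot e t B σ hBσ hunit q hq⟩

/-- **The PRE-HULL reading HOLDS at `v⃗`**: the orbit member `perm_σ(B_{v⃗∘σ}) ⊇ O_{v⃗}` offers the admissible
sub-region `O_{v⃗}` of log-volume `0 ≥ log‖q̲‖`. [claim: Mochizuki2012, status: disputed] -/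
theorem singleImageReading_of_unit_slot : SingleImageReading p 𝔽 e q B := by
  refine ⟨1, σ, (realPrimePacket p 𝔽).O j e, O_subset_orbitMember e t B σ hBσ hunit,
    (realPrimePacket p 𝔽).O_adm j e, ?_⟩
  rw [logμ_pilotRegion, (realPrimePacket p 𝔽).logμ_O]
  exact Real.log_nonpos (norm_nonneg _) hq

/-- **R0 and R4′ HOLD at `v⃗`** as soon as the Θ-hull is admissible (e.g. by XXVI `thetaHull_bound` under the full
sharp-(Ind3) sandwich): monotonicity of `log μ̄`. [claim: Mochizuki2012, status: disputed] -/
theorem volumeReadings_of_unit_slot (hadm : (realPrimePacket p 𝔽).adm (thetaHull p 𝔽 e B)) :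
    VolumeReading p 𝔽 e q B ∧ IsoVolReading p 𝔽 e q B :=
  ⟨(realPrimePacket p 𝔽).logμ_mono (adm_pilotRegion p 𝔽 e q) hadm
      (subsetReading_of_unit_slot e t B σ hBσ hunit q hq),
    ⟨pilotRegion p 𝔽 e q, subsetReading_of_unit_slot e t B σ hBσ hunit q hq, adm_pilotRegion p 𝔽 e q, rfl⟩⟩

/-- **ALL summand readings HOLD at a summand with a unit theta slot** (hull admissible), however deep `q̲` is.
[claim: Mochizuki2012, status: disputed] -/
theorem readings_hold_of_unit_slot (hadm : (realPrimePacket p 𝔽).adm (thetaHull p 𝔽 e B)) :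
    VolumeReading p 𝔽 e q B ∧ SubsetReading p 𝔽 e q B ∧ MemReading p 𝔽 e q B ∧ IsoReading p 𝔽 e q B ∧
      IsoVolReading p 𝔽 e q B ∧ SingleImageReading p 𝔽 e q B :=
  ⟨(volumeReadings_of_unit_slot e t B σ hBσ hunit q hq hadm).1, subsetReading_of_unit_slot e t B σ hBσ hunit q hq,
    memReading_of_unit_slot e t B σ hBσ hunit q hq, isoReading_of_unit_slot e t B σ hBσ hunit q hq,
    (volumeReadings_of_unit_slot e t B σ hBσ hunit q hq hadm).2,
    singleImageReading_of_unit_slot e t B σ hBσ hunit q hq⟩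

end UnitSlot

/-! ## 4. Non-vacuity: the Θ-pilot concentrated at one bad place, read at any off-diagonal summand -/

/-- **Off-diagonal summands of a one-bad-place Θ-pilot.** Fix a place `v | p` and theta values concentrated at
`v` — `t_v := p^{N·j²}` (as deep as desired), `t_u := 1` at every other place `u | p` — with the SHARP bare
regions as (Ind3)-data. Then at EVERY summand `v⃗` having a slot `i₁` at a place `≠ v`, the set-level readings R2,
R3, R4 and the pre-hull reading HOLD for EVERY integral q-value `q̲` at `v⃗`'s last place (in particular for
`q̲ = q̲_v` when that last place is `v`, however large `N`). Together with XXVI/XXVIb at the diagonal summand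
`(v,…,v)` (all readings FALSE once `N` is large) this is the packet-level competition in one real packet.
[folklore] -/
theorem readings_hold_off_diagonal {j : ℕ} (v : placesOver F p) (N : ℕ)
    (e : Fin (j + 1) → placesOver F p) (i₁ : Fin (j + 1)) (hi : e i₁ ≠ v) :
    ∃ (t : ∀ u : placesOver F p, (𝔽.k u)ˣ) (B : (realPrimePacket p 𝔽).Region),
      ‖(t v : 𝔽.k v)‖ = ‖(p : 𝔽.k v)‖ ^ (N * j ^ 2) ∧ (∀ u, u ≠ v → ‖(t u : 𝔽.k u)‖ = 1) ∧
      (∀ σ : Equiv.Perm (Fin (j + 1)), B j (e ∘ σ) = pilotRegion p 𝔽 (e ∘ σ) (t (e (σ (Fin.last j))))) ∧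
      ∀ q : (𝔽.k (e (Fin.last j)))ˣ, ‖(q : 𝔽.k (e (Fin.last j)))‖ ≤ 1 →
        SubsetReading p 𝔽 e q B ∧ MemReading p 𝔽 e q B ∧ IsoReading p 𝔽 e q B ∧ SingleImageReading p 𝔽 e q B := by
  classical
  set t : ∀ u : placesOver F p, (𝔽.k u)ˣ :=
    Function.update (fun u => (1 : (𝔽.k u)ˣ)) v (primeUnit p (𝔽.k v) ^ (N * j ^ 2)) with ht
  refine ⟨t, fun j' e' => pilotRegion p 𝔽 e' (t (e' (Fin.last j'))), ?_, ?_, fun σ => rfl, ?_⟩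
  · rw [ht, Function.update_self]
    simp only [Units.val_pow_eq_pow_val, coe_primeUnit, norm_pow]
  · intro u hu
    rw [ht, Function.update_of_ne hu, Units.val_one, norm_one]
  · intro q hq
    set σ : Equiv.Perm (Fin (j + 1)) := Equiv.swap (Fin.last j) i₁ with hσ
    have hσi : σ (Fin.last j) = i₁ := by rw [hσ, Equiv.swap_apply_left]
    have hunit : ‖(t (e (σ (Fin.last j))) : 𝔽.k (e (σ (Fin.last j))))‖ = 1 := by
      rw [hσi, ht, Function.update_of_ne hi, Units.val_one, norm_one]
    have hBσ : pilotRegion p 𝔽 (e ∘ σ) (t (e (σ (Fin.last j)))) ⊆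
        (fun j' e' => pilotRegion p 𝔽 e' (t (e' (Fin.last j')))) j (e ∘ σ) := Subset.rfl
    exact ⟨subsetReading_of_unit_slot e t _ σ hBσ hunit q hq, memReading_of_unit_slot e t _ σ hBσ hunit q hq,
      isoReading_of_unit_slot e t _ σ hBσ hunit q hq, singleImageReading_of_unit_slot e t _ σ hBσ hunit q hq⟩

end Summit.ABC.IUTFork.PacketReal

end
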